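import Literature.MathematicalPhysics.QuantumLattice.TorusWilsonMarkov
import Literature.MathematicalPhysics.QuantumLattice.WilsonBlockHeatBathMarkov3
import Summits.QuantumFields.YangMills.Theorems.FradkinShenkerFlowSusceptibilityToPoincareTwoBlockFactorization

/-!
# Variance retention is dual to a projection bound (crux `ConvexGribovBody.PoincareToGap`, line `Sketch`, stub H1a)

Torus Wilson state `μ = wilsonMeasure r.ρ β` on `GaugeConfig 4 (2S+1) G`, `P_D := μ[· | cylinderEvents D]` the
conditional expectation given the link variables in a link set `D`.

`stub_retention_of_projectionBound`: for ANY two link sets `E, O` and `0 ≤ θ`, if every bounded measurable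
gauge-invariant `h` reading only the links of `O` has the PROJECTION BOUND `Var(P_E h) ≤ θ · Var h`, then every
bounded measurable gauge-invariant `F` reading only the links of `E` RETAINS the fraction `1 − θ` of its
variance when the complement of `O` is resampled: `(1 − θ) Var F ≤ ∫ (F − P_O F)²`.

Proof (Hilbert-space duality).  Centre `F₀ := F − ∫ F` (`P_O` commutes with subtracting a constant).  The only
Wilson-specific input is a GOOD VERSION `h` of `P_O F₀`: measurable, bounded, gauge invariant EVERYWHERE and
reading only `O` (`exists_good_version`: the truncated `𝓕_O`-measurable version
`WilsonBlockHeatBath.exists_version_condExp_linkSigma` is a.e. invariant under every gauge transformation by the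
gauge covariance of conditional expectations `WilsonBlockHeatBath.condExp_linkSigma_comp_gaugeTransform` and the
gauge invariance of `F₀` and `μ`; averaging over the compact gauge group keeps the locality because gauge
transformations act link by link).  Then, with `x² := ‖P_O F₀‖₂² = ∫ h²` and `t := ‖F₀‖₂`, pulling out twice,
`x² = ∫ (P_O F₀) h = ∫ F₀ h = ∫ (P_E h) F₀ = ∫ (P_E h − ∫ h) F₀ ≤ t · √(θ Var h) ≤ t √θ x`
(Cauchy–Schwarz, the hypothesis for `h`, `Var h ≤ ∫ h²`), so `x² ≤ θ t²`, and Pythagoras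
`∫ (F₀ − P_O F₀)² = t² − x² ≥ (1 − θ) t²`.  The `L²` part is abstract (any probability space,
`retention_of_projectionBound_abstract`).

References: F. Martinelli, LNM 1717 (1999), §3 (block heat-bath projections in `L²`); E. Seiler, LNP 159 (1982),
§1 (gauge transformations); H.-O. Georgii, *Gibbs Measures and Phase Transitions* (2011), §1.2.
-/

noncomputable section

open scoped BigOperators Topology
open MeasureTheory ProbabilityTheory Filter
open Literature.MathematicalPhysics.QuantumFieldTheory Literature.MathematicalPhysics.QuantumLattice

namespace Summit.QuantumFields.YangMills.Theorems.PoincareToGap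

open Summit.QuantumFields.YangMills.Theorems.SusceptibilityToPoincare

/-! ### Abstract `L²` duality on a probability space -/

section L2

variable {Ω : Type*} {m0 : MeasurableSpace Ω} {μ : Measure Ω}

/-- A measurable real function bounded by `M` is in `L²` of a finite measure. -/
private theorem memLp_two_of_bound [IsFiniteMeasure μ] {f : Ω → ℝ} (hf : Measurable f) {M : ℝ}
    (hb : ∀ x, |f x| ≤ M) : MemLp f 2 μ :=
  MemLp.of_bound hf.aestronglyMeasurable M (ae_of_all _ fun x => by rw [Real.norm_eq_abs]; exact hb x)

/-- On a probability space the variance is at most the second moment: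
`∫ (h − ∫ h)² = ∫ h² − (∫ h)² ≤ ∫ h²`. -/
private theorem integral_sub_average_sq_le [IsProbabilityMeasure μ] {h : Ω → ℝ} (hh : MemLp h 2 μ) :
    ∫ ω, (h ω - ∫ v, h v ∂μ) ^ 2 ∂μ ≤ ∫ ω, h ω ^ 2 ∂μ := by
  set c := ∫ v, h v ∂μ with hc
  have hi : Integrable h μ := hh.integrable one_le_two
  have e : ∀ ω, (h ω - c) ^ 2 = (h ω ^ 2 - (2 * c) * h ω) + c ^ 2 := fun ω => by ring
  have i1 : Integrable (fun ω => h ω ^ 2 - (2 * c) * h ω) μ := hh.integrable_sq.sub' (hi.const_mul _)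
  simp_rw [e]
  rw [integral_add i1 (integrable_const _), integral_sub hh.integrable_sq (hi.const_mul _),
    integral_const_mul, integral_const, probReal_univ, one_smul, ← hc]
  nlinarith [sq_nonneg c]

/-- **Duality, abstract form.**  On a probability space with sub-σ-algebras `m_E, m_O`, let `F₀ ∈ L²` be
`m_E`-measurable and centred, let `h ∈ L²` be an `m_O`-measurable version of `P_O F₀ := μ[F₀ | m_O]`, and
suppose `∫ (P_E h − ∫ h)² ≤ θ ∫ (h − ∫ h)²` with `0 ≤ θ`.  Then `(1 − θ) ∫ F₀² ≤ ∫ (F₀ − P_O F₀)²`: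
indeed `∫ h² = ∫ (P_O F₀) h = ∫ F₀ h = ∫ (P_E h) F₀ = ∫ (P_E h − ∫ h) F₀ ≤ ‖F₀‖₂ √θ ‖h‖₂`, so
`∫ (P_O F₀)² = ∫ h² ≤ θ ∫ F₀²`, and Pythagoras. -/
private theorem retention_of_projectionBound_abstract [IsProbabilityMeasure μ]
    {mE mO : MeasurableSpace Ω} (hE : mE ≤ m0) (hO : mO ≤ m0) {θ : ℝ} (hθ : 0 ≤ θ)
    {F₀ h : Ω → ℝ} (hF2 : MemLp F₀ 2 μ) (hFsm : StronglyMeasurable[mE] F₀) (hF0 : ∫ ω, F₀ ω ∂μ = 0)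
    (hh2 : MemLp h 2 μ) (hhsm : StronglyMeasurable[mO] h) (hhae : h =ᵐ[μ] μ[F₀|mO])
    (hyp : ∫ ω, (μ[h|mE] ω - ∫ v, h v ∂μ) ^ 2 ∂μ ≤ θ * ∫ ω, (h ω - ∫ v, h v ∂μ) ^ 2 ∂μ) :
    (1 - θ) * ∫ ω, F₀ ω ^ 2 ∂μ ≤ ∫ ω, (F₀ ω - μ[F₀|mO] ω) ^ 2 ∂μ := by
  set c := ∫ v, h v ∂μ with hc
  set X := ∫ ω, h ω ^ 2 ∂μ with hX
  set T := ∫ ω, F₀ ω ^ 2 ∂μ with hT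
  have hX0 : 0 ≤ X := integral_nonneg fun ω => sq_nonneg _
  have hT0 : 0 ≤ T := integral_nonneg fun ω => sq_nonneg _
  have hPE2 : MemLp (μ[h|mE]) 2 μ := hh2.condExp one_le_two
  have hPEc2 : MemLp (fun ω => μ[h|mE] ω - c) 2 μ := hPE2.sub (memLp_const c)
  -- `x² = ∫ (P_E h − c) F₀`
  have h1 : X = ∫ ω, (μ[h|mE] ω - c) * F₀ ω ∂μ := by
    calc X = ∫ ω, h ω * h ω ∂μ := by rw [hX]; simp_rw [sq]
      _ = ∫ ω, μ[F₀|mO] ω * h ω ∂μ := by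
          refine integral_congr_ae ?_
          filter_upwards [hhae] with ω hω
          rw [← hω]
      _ = ∫ ω, F₀ ω * h ω ∂μ := TwoBlock.integral_condExp_mul hO hF2 hh2 hhsm
      _ = ∫ ω, h ω * F₀ ω ∂μ := by simp_rw [mul_comm]
      _ = ∫ ω, μ[h|mE] ω * F₀ ω ∂μ := (TwoBlock.integral_condExp_mul hE hh2 hF2 hFsm).symm
      _ = ∫ ω, ((μ[h|mE] ω - c) * F₀ ω + c * F₀ ω) ∂μ := by
          refine integral_congr_ae (ae_of_all _ fun ω => ?_)
          ring
      _ = ∫ ω, (μ[h|mE] ω - c) * F₀ ω ∂μ := by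
          rw [integral_add (TwoBlock.integrable_mul_of_memLp hPEc2 hF2)
            ((hF2.integrable one_le_two).const_mul c), integral_const_mul, hF0, mul_zero, add_zero]
  -- Cauchy–Schwarz and the hypothesis
  have h2 : ∫ ω, (μ[h|mE] ω - c) * F₀ ω ∂μ ≤
      Real.sqrt (∫ ω, (μ[h|mE] ω - c) ^ 2 ∂μ) * Real.sqrt T :=
    TwoBlock.integral_mul_le_sqrt_mul_sqrt hPEc2 hF2
  have h3 : ∫ ω, (μ[h|mE] ω - c) ^ 2 ∂μ ≤ θ * X :=
    hyp.trans (mul_le_mul_of_nonneg_left (integral_sub_average_sq_le hh2) hθ)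
  have h4 : Real.sqrt (∫ ω, (μ[h|mE] ω - c) ^ 2 ∂μ) ≤ Real.sqrt θ * Real.sqrt X := by
    rw [← Real.sqrt_mul hθ]
    exact Real.sqrt_le_sqrt h3
  -- `x² ≤ (√θ t) x`, hence `x² ≤ θ t²`
  set a := Real.sqrt θ * Real.sqrt T with ha
  have ha2 : a ^ 2 = θ * T := by rw [ha, mul_pow, Real.sq_sqrt hθ, Real.sq_sqrt hT0]
  have hb2 : Real.sqrt X ^ 2 = X := Real.sq_sqrt hX0
  have key : X ≤ a * Real.sqrt X := by
    calc X ≤ Real.sqrt (∫ ω, (μ[h|mE] ω - c) ^ 2 ∂μ) * Real.sqrt T := h1.trans_le h2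
      _ ≤ Real.sqrt θ * Real.sqrt X * Real.sqrt T :=
          mul_le_mul_of_nonneg_right h4 (Real.sqrt_nonneg _)
      _ = a * Real.sqrt X := by rw [ha]; ring
  have hXT : X ≤ θ * T := by nlinarith [sq_nonneg (a - Real.sqrt X)]
  -- Pythagoras
  have hPyth : ∫ ω, (F₀ ω - μ[F₀|mO] ω) ^ 2 ∂μ = T - ∫ ω, (μ[F₀|mO] ω) ^ 2 ∂μ :=
    TwoBlock.integral_sub_condExp_sq hO hF2
  have hXX : ∫ ω, (μ[F₀|mO] ω) ^ 2 ∂μ = X := integral_sq_congr_ae hhae.symm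
  rw [hPyth, hXX]
  nlinarith

end L2

/-! ### Gauge averaging keeping locality -/

/-- **Invariant local versions by averaging over the compact gauge group**: a bounded measurable function `h`
of the links, reading only the links in `T`, with `h ∘ (·)^g = h` `μ`-a.e. for every gauge transformation `g`
(any s-finite `μ`) is `μ`-a.e. equal to the bounded measurable, everywhere gauge-invariant function
`U ↦ ∫ h(U^{g⁻¹}) dg` (Haar probability on `G^{sites}`), which still reads only the links in `T` because gauge
transformations act link by link. -/
private theorem exists_isGaugeInvariant_dependsOn_version {G : Type} [Group G] [TopologicalSpace G]
    [IsTopologicalGroup G] [CompactSpace G] [MeasurableSpace G] [BorelSpace G]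
    [SecondCountableTopology G] {N : ℕ} [NeZero N] (μ : Measure (GaugeConfig 4 N G)) [SFinite μ]
    {h : GaugeConfig 4 N G → ℝ} (hm : Measurable h) {B : ℝ} (hB : ∀ U, |h U| ≤ B)
    {T : Set (Edge 4 N)} (hT : DependsOn h T)
    (hinv : ∀ g : Site 4 N → G, h ∘ gaugeTransform g =ᵐ[μ] h) :
    ∃ h' : GaugeConfig 4 N G → ℝ, Measurable h' ∧ (∀ U, |h' U| ≤ B) ∧ IsGaugeInvariant h' ∧
      DependsOn h' T ∧ h' =ᵐ[μ] h := by
  -- adapted from Literature/MathematicalPhysics/QuantumLattice/WilsonBlockHeatBathMarkov3.lean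
  -- (`WilsonBlockHeatBath.exists_isGaugeInvariant_version`), recording in addition the locality of the average
  set ν : Measure (Site 4 N → G) := Measure.pi fun _ => haarProbability G
  -- joint measurability of the action
  have hΦ : Measurable fun q : (Site 4 N → G) × GaugeConfig 4 N G => gaugeTransform q.1⁻¹ q.2 := by
    refine measurable_pi_lambda _ fun e => ?_
    simp only [gaugeTransform, Pi.inv_apply, inv_inv]
    exact ((((measurable_pi_apply e.1).comp measurable_fst).inv).mul
      ((measurable_pi_apply e).comp measurable_snd)).mul ((measurable_pi_apply _).comp measurable_fst)
  have hjoint : Measurable fun q : (Site 4 N → G) × GaugeConfig 4 N G => h (gaugeTransform q.1⁻¹ q.2) :=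
    hm.comp hΦ
  refine ⟨fun U => ∫ g, h (gaugeTransform g⁻¹ U) ∂ν,
    (hjoint.stronglyMeasurable.integral_prod_left' (μ := ν)).measurable, fun U => ?_, fun g' U => ?_,
    fun U V hUV => ?_, ?_⟩
  · -- bound
    have := norm_integral_le_of_norm_le_const (μ := ν) (f := fun g => h (gaugeTransform g⁻¹ U)) (C := B)
      (ae_of_all _ fun g => by rw [Real.norm_eq_abs]; exact hB _)
    rwa [Real.norm_eq_abs, probReal_univ, mul_one] at this
  · -- invariance: left invariance of the Haar measure of `G^{sites}`
    have hrw : ∀ g : Site 4 N → G, h (gaugeTransform g⁻¹ (gaugeTransform g' U)) =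
        (fun k : Site 4 N → G => h (gaugeTransform k⁻¹ U)) (g'⁻¹ * g) := fun g => by
      simp only [WilsonBlockHeatBath.gaugeTransform_gaugeTransform, mul_inv_rev, inv_inv]
    simp_rw [hrw]
    exact integral_mul_left_eq_self (fun k : Site 4 N → G => h (gaugeTransform k⁻¹ U)) g'⁻¹
  · -- locality: gauge transformations act link by link
    show ∫ g, h (gaugeTransform g⁻¹ U) ∂ν = ∫ g, h (gaugeTransform g⁻¹ V) ∂ν
    refine integral_congr_ae (ae_of_all _ fun g => hT fun e he => ?_)
    simp only [gaugeTransform, hUV e he]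
  · -- a.e. equality: Fubini
    have H1 : ∀ᵐ g ∂ν, ∀ᵐ U ∂μ, h (gaugeTransform g⁻¹ U) = h U :=
      ae_of_all _ fun g => hinv g⁻¹
    have hmeas : MeasurableSet
        {q : (Site 4 N → G) × GaugeConfig 4 N G | h (gaugeTransform q.1⁻¹ q.2) = h q.2} :=
      measurableSet_eq_fun hjoint (hm.comp measurable_snd)
    have H2 : ∀ᵐ U ∂μ, ∀ᵐ g ∂ν, h (gaugeTransform g⁻¹ U) = h U := (Measure.ae_ae_comm hmeas).1 H1
    filter_upwards [H2] with U hU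
    rw [integral_congr_ae hU, integral_const, probReal_univ, one_smul]

/-! ### A good version of the heat-bath average of a gauge-invariant function -/

/-- **Good versions of heat-bath averages** (the only Wilson-specific step): for the torus Wilson state `μ`,
a link set `O` and a bounded measurable gauge-invariant `F`, the conditional expectation `μ[F | 𝓕_O]` has a
version which is measurable, bounded by the same constant, gauge invariant EVERYWHERE and reads only the links
of `O`.  The truncated `𝓕_O`-measurable version (`WilsonBlockHeatBath.exists_version_condExp_linkSigma`) is a.e.
invariant under every gauge transformation (gauge covariance `WilsonBlockHeatBath.condExp_linkSigma_comp_gaugeTransform`,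
invariance of `F` and of `μ`); average it over the compact gauge group keeping the locality. -/
private theorem exists_good_version {G : Type} [Group G] [TopologicalSpace G] [IsTopologicalGroup G]
    [CompactSpace G] [MeasurableSpace G] [BorelSpace G] (r : LatticeRep G) (β : ℝ) (S : ℕ)
    (O : Set (Edge 4 (2 * S + 1))) {F : GaugeConfig 4 (2 * S + 1) G → ℝ} (hFm : Measurable F) {B : ℝ}
    (hB : ∀ U, |F U| ≤ B) (hFi : IsGaugeInvariant F) :
    ∃ h : GaugeConfig 4 (2 * S + 1) G → ℝ, Measurable h ∧ (∀ U, |h U| ≤ B) ∧ IsGaugeInvariant h ∧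
      DependsOn h O ∧
      h =ᵐ[(wilsonMeasure r.ρ β : Measure (GaugeConfig 4 (2 * S + 1) G))]
        condExp (cylinderEvents O) (wilsonMeasure r.ρ β : Measure (GaugeConfig 4 (2 * S + 1) G)) F := by
  haveI : SecondCountableTopology G :=
    (r.continuous.isClosedEmbedding r.injective).isEmbedding.secondCountableTopology
  haveI : T2Space G := (r.continuous.isClosedEmbedding r.injective).isEmbedding.t2Space
  haveI : IsProbabilityMeasure (wilsonMeasure r.ρ β : Measure (GaugeConfig 4 (2 * S + 1) G)) :=
    isProbabilityMeasure_wilsonMeasure (d := 4) (L := 2 * S + 1) r.ρ r.continuous β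
  -- (a) a bounded local version
  obtain ⟨F₁, hF₁m, hF₁b, hF₁dep, hF₁ae⟩ :=
    WilsonBlockHeatBath.exists_version_condExp_linkSigma (N := 2 * S + 1) r.ρ β O hB
  -- (b) it is a.e. gauge invariant
  have hFint : Integrable F (wilsonMeasure r.ρ β : Measure (GaugeConfig 4 (2 * S + 1) G)) :=
    Integrable.of_bound hFm.aestronglyMeasurable B
      (ae_of_all _ fun U => by rw [Real.norm_eq_abs]; exact hB U)
  have hinv : ∀ g : Site 4 (2 * S + 1) → G,
      F₁ ∘ gaugeTransform g =ᵐ[(wilsonMeasure r.ρ β : Measure (GaugeConfig 4 (2 * S + 1) G))] F₁ := by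
    intro g
    have hq : Measure.QuasiMeasurePreserving (gaugeTransform g)
        (wilsonMeasure r.ρ β : Measure (GaugeConfig 4 (2 * S + 1) G)) (wilsonMeasure r.ρ β) :=
      (⟨WilsonBlockHeatBath.measurable_gaugeTransform g,
          wilsonMeasure_map_gaugeTransform_holds (d := 4) (L := 2 * S + 1) r.ρ β g⟩ :
        MeasurePreserving (gaugeTransform g) (wilsonMeasure r.ρ β) (wilsonMeasure r.ρ β)).quasiMeasurePreserving
    have h1 := hq.ae_eq_comp hF₁ae
    have h2 := WilsonBlockHeatBath.condExp_linkSigma_comp_gaugeTransform r.ρ r.continuous β O g hFint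
    have hfg : F ∘ gaugeTransform g = F := funext fun U => hFi g U
    rw [hfg] at h2
    exact h1.trans (h2.symm.trans hF₁ae.symm)
  -- (c) average over the gauge group keeping the locality
  obtain ⟨h, hm, hb, hGI, hdep, hae⟩ :=
    exists_isGaugeInvariant_dependsOn_version _ hF₁m hF₁b hF₁dep hinv
  refine ⟨h, hm, hb, hGI, hdep, ?_⟩
  have hae' := hae.trans hF₁ae
  rw [WilsonBlockHeatBath.linkSigma_eq_cylinderEvents] at hae'
  exact hae'

/-! ### The stub -/

/-- `stub_retention_of_projectionBound` — **DUALITY (H1a of the line `Sketch`)**: variance retention under a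
heat-bath projection is the dual of a projection bound.  For the torus Wilson state `μ`, ANY two link sets
`E, O` and `0 ≤ θ`: if every bounded measurable gauge-invariant `h` reading only the links of `O` has
`Var(E_μ[h | 𝓕_E]) ≤ θ · Var h`, then every bounded measurable gauge-invariant `F` reading only the links of `E`
keeps the fraction `1 − θ` of its variance when the complement of `O` is resampled:
`(1 − θ) Var F ≤ ∫ (F − E_μ[F | 𝓕_O])²`.  Proof: with `F₀ = F − ∫F` and `h` a bounded measurable
gauge-invariant version of `P_O F₀` reading only `O` (`exists_good_version`), pull-out twice gives
`‖P_O F₀‖² = ∫ F₀ h = ∫ F₀ (P_E h − ∫ h) ≤ ‖F₀‖ √θ ‖h‖ = √θ ‖F₀‖ ‖P_O F₀‖`, hence `‖P_O F₀‖² ≤ θ ‖F₀‖²` and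
Pythagoras (`retention_of_projectionBound_abstract`). -/
theorem stub_retention_of_projectionBound :
    ∀ (G : Type) [Group G] [TopologicalSpace G] [IsTopologicalGroup G] [CompactSpace G]
      [MeasurableSpace G] [BorelSpace G] (r : LatticeRep G) (β : ℝ) (S : ℕ)
      (μ : Measure (GaugeConfig 4 (2 * S + 1) G)),
      μ = (wilsonMeasure r.ρ β : Measure (GaugeConfig 4 (2 * S + 1) G)) →
    ∀ (E O : Set (Edge 4 (2 * S + 1))) (θ : ℝ), 0 ≤ θ →
    (∀ h : GaugeConfig 4 (2 * S + 1) G → ℝ, Measurable h → (∃ M : ℝ, ∀ U, |h U| ≤ M) →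
      IsGaugeInvariant h → DependsOn h O →
      ∫ U, (condExp (cylinderEvents E) μ h U - ∫ V, h V ∂μ) ^ 2 ∂μ ≤
        θ * ∫ U, (h U - ∫ V, h V ∂μ) ^ 2 ∂μ) →
    ∀ F : GaugeConfig 4 (2 * S + 1) G → ℝ, Measurable F → (∃ M : ℝ, ∀ U, |F U| ≤ M) →
      IsGaugeInvariant F → DependsOn F E →
    (1 - θ) * ∫ U, (F U - ∫ V, F V ∂μ) ^ 2 ∂μ ≤
      ∫ U, (F U - condExp (cylinderEvents O) μ F U) ^ 2 ∂μ := by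
  intro G _ _ _ _ _ _ r β S μ hμ E O θ hθ hPB F hFm hFb hFGI hFdep
  obtain ⟨M, hFb⟩ := hFb
  haveI : IsProbabilityMeasure μ := by
    rw [hμ]
    exact isProbabilityMeasure_wilsonMeasure (d := 4) (L := 2 * S + 1) r.ρ r.continuous β
  have hE : cylinderEvents (X := fun _ : Edge 4 (2 * S + 1) => G) E ≤ MeasurableSpace.pi :=
    cylinderEvents_le_pi
  have hO : cylinderEvents (X := fun _ : Edge 4 (2 * S + 1) => G) O ≤ MeasurableSpace.pi :=
    cylinderEvents_le_pi
  have hFint : Integrable F μ := (memLp_two_of_bound hFm hFb).integrable one_le_two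
  have hcF : |∫ U, F U ∂μ| ≤ M := by
    have h := norm_integral_le_of_norm_le_const (μ := μ) (f := F) (C := M)
      (ae_of_all _ fun U => by rw [Real.norm_eq_abs]; exact hFb U)
    rwa [Real.norm_eq_abs, probReal_univ, mul_one] at h
  -- the centred observable `F₀ = F - ∫ F`
  set c := ∫ V, F V ∂μ with hc
  obtain ⟨F₀, hF₀⟩ : ∃ F₀ : GaugeConfig 4 (2 * S + 1) G → ℝ, ∀ U, F₀ U = F U - c := ⟨_, fun U => rfl⟩
  have hF₀' : F₀ = fun U => F U - c := funext hF₀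
  have h0m : Measurable F₀ := by rw [hF₀']; exact hFm.sub measurable_const
  have h0b : ∀ U, |F₀ U| ≤ 2 * M := fun U => by
    rw [hF₀]
    calc |F U - c| ≤ |F U| + |c| := abs_sub _ _
      _ ≤ M + M := add_le_add (hFb U) hcF
      _ = 2 * M := by ring
  have h0GI : IsGaugeInvariant F₀ := fun q U => by rw [hF₀, hF₀, hFGI q U]
  have h0dep : DependsOn F₀ E := fun U V hUV => by rw [hF₀, hF₀, hFdep hUV]
  have h0int : ∫ U, F₀ U ∂μ = 0 := by
    rw [hF₀', integral_sub hFint (integrable_const _), integral_const, probReal_univ, one_smul, ← hc, sub_self]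
  have h02 : MemLp F₀ 2 μ := memLp_two_of_bound h0m h0b
  have h0sm : StronglyMeasurable[cylinderEvents (X := fun _ : Edge 4 (2 * S + 1) => G) E] F₀ :=
    (h0m.measurable_cylinderEvents_of_dependsOn h0dep).stronglyMeasurable
  -- a good version `h` of `P_O F₀`
  obtain ⟨h, hm, hb, hGI, hdep, hae⟩ :
      ∃ h : GaugeConfig 4 (2 * S + 1) G → ℝ, Measurable h ∧ (∀ U, |h U| ≤ 2 * M) ∧ IsGaugeInvariant h ∧
        DependsOn h O ∧ h =ᵐ[μ] condExp (cylinderEvents O) μ F₀ := by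
    subst hμ
    exact exists_good_version r β S O h0m h0b h0GI
  have hh2 : MemLp h 2 μ := memLp_two_of_bound hm hb
  have hhsm : StronglyMeasurable[cylinderEvents (X := fun _ : Edge 4 (2 * S + 1) => G) O] h :=
    (hm.measurable_cylinderEvents_of_dependsOn hdep).stronglyMeasurable
  -- the projection bound for `h` and the abstract duality
  have hyp := hPB h hm ⟨2 * M, hb⟩ hGI hdep
  have key := retention_of_projectionBound_abstract hE hO hθ h02 h0sm h0int hh2 hhsm hae hyp
  -- back to `F`
  have hPO : condExp (cylinderEvents O) μ F₀ =ᵐ[μ] fun U => condExp (cylinderEvents O) μ F U - c := by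
    have h1 : F₀ = F - fun _ => c := funext fun U => by rw [hF₀]; rfl
    rw [h1]
    refine (condExp_sub hFint (integrable_const c) _).trans ?_
    rw [condExp_const hO c]
    exact EventuallyEq.rfl
  have hL : ∫ U, (F U - ∫ V, F V ∂μ) ^ 2 ∂μ = ∫ U, F₀ U ^ 2 ∂μ := by
    simp_rw [← hc, hF₀]
  have hR : ∫ U, (F U - condExp (cylinderEvents O) μ F U) ^ 2 ∂μ =
      ∫ U, (F₀ U - condExp (cylinderEvents O) μ F₀ U) ^ 2 ∂μ := by
    refine integral_congr_ae ?_
    filter_upwards [hPO] with U hU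
    rw [hU, hF₀]
    ring
  rw [hL, hR]
  exact key

end Summit.QuantumFields.YangMills.Theorems.PoincareToGap

end
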